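import Summits.HodgeConjecture.HodgeConjecture.Theses.NodalThetaWeil
import Literature.AlgebraicGeometry.HodgeTheory.WeilClassesHodgeType
import Literature.AlgebraicGeometry.HodgeTheory.HodgeLocus
import Literature.AlgebraicGeometry.HodgeTheory.GlobalInvariantCycles
import Literature.AlgebraicGeometry.HodgeTheory.ClassesSupportedOn
import Literature.AlgebraicGeometry.HodgeTheory.IsoTransport
import Literature.AlgebraicGeometry.HodgeTheory.GysinFormalismPushforward
import Literature.AlgebraicGeometry.Motives.FamiliesVHS

/-!
# Line `support-transport` of the crux `NodalThetaSupport` (stmt-HodgeConjecture-7744), route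
# `NodalThetaWeil` — "supports of a flat class propagate along a family of pairs; seed at a special
# fibre" (transfer-to-a-special-fibre lens)

Crux `X1 = NodalThetaSupport`: every rational `(3,3)` Weil class `c` of an abelian sixfold of Weil
type `(A, φ ≫ φ = -d·𝟙)` lies in `N¹H⁶ = supportedClasses A.X 6 1`.

Line `birth` must produce, for EVERY `A`, a nodal member of `|kΘ|` supporting a `W`-visible class.
This line replaces "for every `A`" by "for ONE sufficiently general seed fibre of a family through
`A`", using two facts of the topology of algebraic families which hold for ANY closed `𝒟 ⊆ 𝒳` in a
smooth projective family `f : 𝒳 → S` and ANY flat (= continuous, étalé topology of `R⁶f_*ℂ`,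
`HodgeTheory/HodgeLocus`) section `σ` of fibre classes:

  STUB S1 (specialisation of supports, L): the SUPPORT LOCUS
  `Σ(σ, 𝒟) = {s ∈ S(ℂ) : σ(s) dies on (𝒳_s ∖ 𝒟_s)(ℂ)}` is closed under specialisation — if it
  contains the complex points of a non-empty Zariski-open `U ⊆ S` (`S` irreducible) it is all of
  `S(ℂ)`. Mechanism: over a small ball `B ∋ s₀` the proper `𝒟_B` retracts onto `𝒟_{s₀}`
  (Łojasiewicz / Durfee neighbourhoods; proper base change), so `H₆(𝒟_s) → H₆(𝒟_B) ≅ H₆(𝒟_{s₀})`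
  is a specialisation map compatible with `H₆(𝒳_s) ≅ H₆(𝒳_{s₀})`, and "`σ(s) ∈ Im H₆(𝒟_s)`"
  (Alexander–Lefschetz duality `H⁶_{𝒟_s}(𝒳_s) ≅ H₆(𝒟_s)`) passes to the limit; `U(ℂ)` is dense
  in `S(ℂ)` for the analytic topology.

  STUB S2 (generic transport, L): there is a non-empty Zariski-open `U ⊆ S` over which
  `Σ(σ, 𝒟) ∩ U(ℂ)` is all-or-nothing. Mechanism: Verdier's generic topological triviality
  (Whitney–Bertini–Sard: the proper pair `(𝒳, 𝒟) → S` is topologically locally trivial over a dense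
  Zariski-open `U`), so `s ↦ Im(H⁶_{𝒟_s}(𝒳_s) → H⁶(𝒳_s))` is a flat sub-bundle of `R⁶f_*ℂ|_U`; the
  flat section `σ` lies in it on an open-closed subset of `U(ℂ)`, which is connected (`U`
  irreducible).

  STUB S3 (THE HEART, open — the crux relocated to ONE special fibre): for every balanced Weil
  sixfold `(A, φ, d)` and every non-zero rational `(3,3)` Weil class `c` there are a smooth projective
  family `f : 𝒳 → S` over a smooth irreducible quasi-projective base with `A ≅ 𝒳_{s₁}`, a flat
  section `σ` through `c`, and a closed `𝒟 ⊆ 𝒳` whose slice over `s₁` is a PROPER subset of the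
  fibre, such that the SEEDS — points `s₂` where `σ(s₂)` is ALGEBRAIC (so independently known:
  Deligne's diagonal CM point `E_K⁶`, Hecke translates of the product locus `A₄ × A₂` by Markman's
  fourfold theorem + Schoen's product step + isogeny descent, all in the tree) AND supported on
  `𝒟_{s₂}` — are Zariski-dense in `S`. Intended witnesses: Deligne's Weil family (LNM 900, proof of
  Thm. 4.8: flat Weil classes, `deligne1982_weilFamily_flatWeilSection` pattern) base-changed to the
  irreducible relative family `T → S` of `m`-nodal members of `|kΘ_t|` with `≥ 3k` nodes in
  `|3kΘ|`-special position (positive defect `h¹(I_Σ(3kΘ_t)) > 0` — Thomas 2005 §5 / Schoen 1985 /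
  Cynk 2001 — is NECESSARY for a nodal member to support anything outside `θ ∪ H⁴`, and Bauer–Szemberg
  `(k+2)Θ` is `k`-very ample, so `≤ 3k - 1` nodes never suffice: in particular the single
  Kummer-tangent section of `birth`'s first regime, `2` nodes, supports NOTHING new), and ONE seed
  computation at the CM fibre `E_K⁶` (exact arithmetic: theta functions with CM period matrix;
  vanishing-cycle relations of a product-type degeneration).

  COMPOSITION `NodalThetaSupport_of : S1 → S2 → S3 → NodalThetaSupport` (real proof): `c = 0`
  trivial; else `(A, φ)` balanced (Deligne–Milne 4.4 "only if", `finrank_eq_of_mem_weilClassesOf`,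
  PROVED in the tree); S3 gives `(f, s₁, e, σ, 𝒟)`; S2 gives `U`; S3's density gives a seed in `U`;
  S2 propagates support over `U(ℂ)`; S1 to `s₁`; `e^{-1 *}c` is supported on a proper closed subset of
  the smooth projective fibre, hence in `N¹` (`one_le_coheight_of_mem_of_isClosed`,
  `classesSupportedOn_le_supportedClasses`), and `N¹` transports along `e`
  (`mem_supportedClasses_map_iff_of_iso`).

Why it is not costume and not a shred. S1 and S2 are theorems of stratification theory about
ARBITRARY families (no Weil structure, no Hodge theory); S3 is not implied by X1 (the trivial
family `S = {A}` would need `c` ALGEBRAIC at `A`, i.e. the target `WeilSixfolds`, not X1) and does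
not imply X1 without S1–S2; HC ⇒ S3 (Thomas's Prop. 2 + Kleiman + Thm. 6 at every fibre, a
dominating component of the relative Hilbert scheme by countability, seeds = all its points).
Why it dodges the stuck point of `birth`: the existence of the special nodal divisor and of the
`W`-visible relation must be shown at ONE fibre in GENERIC position (an open condition) — at a CM
fibre where the Weil classes are explicit cycles — instead of at every `A`; and the Hodge-theoretic
half is AUTOMATIC along the family: for nodal `D ⊂ A⁶`, `H⁴(D̃) = H⁴(A) ⊕ ℚ(-2)^{μ+δ}` (Thomas 2005
eq. (1) = Schoen 1985 Lemma 1.1), so `H^{1,3}(D̃) = H^{1,3}(A)`, `H^{0,4}(D̃) = H^{0,4}(A)` inject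
under Gysin (hard Lefschetz) and the lifted class stays Hodge wherever `W` does.

Disproof used: none on file for this crux (no `Cruxes/NodalThetaSupport/Disproof.lean`,
2026-08-17); negatives index: 3 entries, none in this sector.

## Contents

* `IsSupportedOnSlice 𝒟 x` — the fibre class `x = (s, α)` dies on `(𝒳_s ∖ 𝒟_s)(ℂ)`.
* `stub_supportLocus_specialisation` (S1), `stub_supportLocus_genericTransport` (S2),
  `stub_seededWeilFamily` (S3) — `sorry` ONLY here.
* `NodalThetaSupport_of` — S1 → S2 → S3 → the crux BY NAME (real proof);
  `NodalThetaSupport_of_stubs`.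
* Sanity: `isSupportedOnSlice_univ` (every fibre class is supported on the slice of `𝒟 = 𝒳`: the
  predicate is inhabited in kind) and `isSupportedOnSlice_zero`.
-/

noncomputable section

namespace Summit.HodgeConjecture.HodgeConjecture.Cruxes.NodalThetaSupport.SupportTransport

open CategoryTheory AlgebraicGeometry
open Literature.AlgebraicGeometry.Motives Literature.AlgebraicGeometry.HodgeTheory
  Literature.AlgebraicTopology.SingularHomology
open Summit.HodgeConjecture.HodgeConjecture.Theses.NodalThetaWeil (NodalThetaSupport)

universe u

/-! ### Fibre classes supported on the slices of a closed subset of the total space -/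

/-- **`x = (s, α)` is supported on the slice `𝒟_s`**: the class `α ∈ H^k(𝒳_s(ℂ); ℂ)` dies on the
complex points of `𝒳_s ∖ 𝒟_s`, where `𝒟_s` is the preimage of `𝒟 ⊆ 𝒳` under the closed-fibre
inclusion `𝒳_s ⟶ 𝒳` (the tree's `classesSupportedOn`). [cite: GrothendieckTopology1969, §1] -/
def IsSupportedOnSlice {𝒳 S : SchemeOver ℂ} {f : 𝒳 ⟶ S} {k : ℕ} (𝒟 : Set 𝒳.left)
    (x : FiberClass f k) : Prop :=
  x.cls ∈ classesSupportedOn (fiberOver f x.pt) ((fiberι f x.pt).left.base ⁻¹' 𝒟) k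

/-! ### The three registered stubs -/

/-- STUB S1 (L; provable from print) — **supports of a flat class specialise.** For a smooth projective
family `f : 𝒳 → S` of relative dimension `n` over an irreducible base, a Zariski-closed `𝒟 ⊆ 𝒳` and a
continuous section `σ` of fibre classes (a flat class), if `σ(s)` is supported on the slice `𝒟_s`
for every complex point `s` of a non-empty Zariski-open `U ⊆ S`, then it is supported on `𝒟_s` for
EVERY complex point `s`. Mechanism: `𝒟|_B` retracts onto `𝒟_{s₀}` over a small ball (proper family),
giving a specialisation map `H₆(𝒟_s) → H₆(𝒟_{s₀})` compatible with `H₆(𝒳_s) ≅ H₆(𝒳_{s₀})`;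
"supported on `𝒟_s`" is "in the image of `H₆(𝒟_s)`" (Alexander–Lefschetz duality); `U(ℂ)` is dense
in `S(ℂ)`. Why it might fail: only through the typing — continuity of `σ` in the étalé topology is
flatness only for `f` smooth proper (assumed), and density of `U(ℂ)` needs `S` irreducible (assumed).
[cite: VoisinHodgeII2003, §3.3.1 and proof of Thm. 10.19 (specialisation of supported classes)]
[cite: Dimca1992, Ch. 1 §5 (conic structure / good neighbourhoods)] [cite: GoreskyMacpherson1980, §1]
[cite: Fulton1998, §10.1 and §20.3 (specialisation)] -/
theorem stub_supportLocus_specialisation :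
    ∀ ⦃𝒳 S : SchemeOver ℂ⦄ (f : 𝒳 ⟶ S) (n k : ℕ), IsSmoothProjectiveFamily f n →
      IrreducibleSpace S.left → IsQuasiProjectiveOver S → IsQuasiProjectiveOver 𝒳 →
      ∀ (𝒟 : Set 𝒳.left), IsClosed 𝒟 →
      ∀ (σ : ComplexPoints S → FiberClass f k), Continuous σ → (∀ s, (σ s).pt = s) →
      ∀ (U : Set S.left), IsOpen U → U.Nonempty →
        (∀ s : ComplexPoints S, s.pt ∈ U → IsSupportedOnSlice 𝒟 (σ s)) →
        ∀ s : ComplexPoints S, IsSupportedOnSlice 𝒟 (σ s) := by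
  sorry

/-- STUB S2 (L; provable from print) — **generic transport of supports.** In the situation of S1
there is a non-empty Zariski-open `U ⊆ S` over which being supported on the slices of `𝒟` is
ALL-OR-NOTHING for the flat class `σ`: if `σ(s₂)` is supported on `𝒟_{s₂}` for one complex point
`s₂` of `U` then `σ(s)` is supported on `𝒟_s` for every complex point `s` of `U`. Mechanism: Verdier's
generic topological triviality of the proper pair `(𝒳, 𝒟) → S` over a dense Zariski-open `U`
(Whitney stratification + Thom–Mather), so `s ↦ Im(H^k_{𝒟_s}(𝒳_s) → H^k(𝒳_s))` is a flat
sub-bundle of `R^k f_*ℂ|_U`; a flat section lies in it on an open and closed subset of `U(ℂ)`, and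
`U(ℂ)` is connected (`U` irreducible). Why it might fail: only through the typing; for `S(ℂ) = ∅` or
`U(ℂ) = ∅` it is vacuous-true, for reducible `S` it would be false (irreducibility assumed).
[cite: Verdier1976, Thm. 3.3 and Cor. 5.1] [cite: GoreskyMacpherson1980, §1.2 (Whitney stratifications)]
[cite: Dimca1992, Ch. 1 Thm. 5.? / Ch. 4 (locally trivial families)] [cite: VoisinHodgeII2003, §9.1–9.2 (local systems, Ehresmann)] -/
theorem stub_supportLocus_genericTransport :
    ∀ ⦃𝒳 S : SchemeOver ℂ⦄ (f : 𝒳 ⟶ S) (n k : ℕ), IsSmoothProjectiveFamily f n →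
      IrreducibleSpace S.left → IsQuasiProjectiveOver S → IsQuasiProjectiveOver 𝒳 →
      ∀ (𝒟 : Set 𝒳.left), IsClosed 𝒟 →
      ∀ (σ : ComplexPoints S → FiberClass f k), Continuous σ → (∀ s, (σ s).pt = s) →
      ∃ U : Set S.left, IsOpen U ∧ U.Nonempty ∧
        ((∃ s₂ : ComplexPoints S, s₂.pt ∈ U ∧ IsSupportedOnSlice 𝒟 (σ s₂)) →
          ∀ s : ComplexPoints S, s.pt ∈ U → IsSupportedOnSlice 𝒟 (σ s)) := by
  sorry

/-- STUB S3 (THE HEART; open — the crux relocated to one special fibre) — **a seeded family for every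
Weil class.** For `d ≥ 1`, `(A, φ ≫ φ = -d·𝟙)` of dimension `6` and balanced type
(`dim (V₊ ∩ H^{1,0}) = 3`), and a non-zero rational `(3,3)`-class `c` of the Weil plane, there are a
smooth projective family `f : 𝒳 → S` of relative dimension `6` over an irreducible smooth
quasi-projective base (with `𝒳` quasi-projective), a point `s₁` with `e : A.X ≅ 𝒳_{s₁}`, a continuous
(flat) section `σ` of `FiberClass f 6` through `e^{-1 *}c`, and a Zariski-closed `𝒟 ⊆ 𝒳` whose slice
over `s₁` is a PROPER subset of `𝒳_{s₁}`, such that in every non-empty Zariski-open `U ⊆ S` there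
is a SEED: a complex point `s₂` of `U` at which `σ(s₂)` is ALGEBRAIC (`∈ algebraicClasses 𝒳_{s₂} 3`)
and supported on the slice `𝒟_{s₂}`. Intended: Deligne's Weil family (flat Weil classes), the
relative family of special-position nodal members of `|kΘ|` (defect `h¹(I_Σ(3kΘ)) > 0`, `≥ 3k`
nodes), seeds at the Hecke orbit of the diagonal CM point `E_K⁶` / of the product locus `A₄ × A₂`
(where `σ` is algebraic by results in the tree + Markman's fourfold theorem), support at the seed
by ONE explicit vanishing-cycle computation in generic position. Status: HC ⇒ S3 (Thomas Prop. 2,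
Thm. 5–6 on every fibre; a dominating component of the relative Hilbert scheme; seeds = all its
points); S1 ∧ S2 ∧ S3 ⇒ X1 (this file). Why it might fail: a universally defined nodal family with
positive defect and `W` in its new part may not exist at any bounded level `k` (Thomas §5: the
equinodal deformation problem is superabundant, obstructions in `H¹(I_Σ(kΘ)) ⊇ H¹(ν_Z)`), and
density of ALGEBRAIC seeds needs HC at a dense set (available only on Hecke orbits of CM/product
points) — informative, not refuting; false outright only with ¬HC.
[cite: Deligne1982HodgeCycles, proof of Thm. 4.8 (pp. 47–52) and Prop. 4.4]
[cite: Thomas2005Nodes, Prop. 2, Thm. 5–6 (p. 6), §5 (pp. 7–8)] [cite: Schoen1985, Lemma 1.1]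
[cite: Cynk2001, Thm. (defect formula)] [cite: Markman2025SecantWeil, Thm. 1.5.1 and §11.5 Step 2]
[cite: vanGeemen1994HodgeAV, 5.4–5.11] -/
theorem stub_seededWeilFamily :
    ∀ (d : ℕ), 0 < d → ∀ (A : AbelianVariety ℂ) (φ : A ⟶ A), A.dim = 2 * 3 →
      ∀ hsp : IsSmoothProjective (2 * 3) A.X, φ ≫ φ = -(d • 𝟙 A) →
      Module.finrank ℂ ↥(Module.End.eigenspace (complexBetti.map φ.hom.hom.hom 1).hom
            (Complex.I * (Real.sqrt d : ℂ)) ⊓ hodgeOneZero hsp) = 3 →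
      ∀ c : complexBetti A.X (2 * 3), c ∈ weilClassesOf A φ 3 d → c ≠ 0 → IsRationalClass c →
        IsOfHodgeType (2 * 3) A.X (2 * 3) 3 3 c →
        ∃ (𝒳 S : SchemeOver ℂ) (f : 𝒳 ⟶ S) (s₁ : ComplexPoints S) (e : A.X ≅ fiberOver f s₁)
          (σ : ComplexPoints S → FiberClass f (2 * 3)) (𝒟 : Set 𝒳.left),
          IsSmoothProjectiveFamily f (2 * 3) ∧ IrreducibleSpace S.left ∧
          AlgebraicGeometry.Smooth S.hom ∧ IsQuasiProjectiveOver S ∧ IsQuasiProjectiveOver 𝒳 ∧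
          IsClosed 𝒟 ∧ Continuous σ ∧ (∀ s, (σ s).pt = s) ∧
          σ s₁ = ⟨s₁, complexBetti.map e.inv (2 * 3) c⟩ ∧
          (fiberι f s₁).left.base ⁻¹' 𝒟 ≠ Set.univ ∧
          ∀ U : Set S.left, IsOpen U → U.Nonempty →
            ∃ s₂ : ComplexPoints S, s₂.pt ∈ U ∧
              (σ s₂).cls ∈ algebraicClasses (fiberOver f (σ s₂).pt) 3 ∧
              IsSupportedOnSlice 𝒟 (σ s₂) := by
  sorry

/-! ### The composition: S1 → S2 → S3 → the crux, by name -/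

/-- **THE LINE'S COMPOSITION** (kernel-checked, no `sorry`): specialisation (S1) and generic transport
(S2) of supports of flat classes, and a seeded family through every Weil class (S3), give
`NodalThetaSupport`. [cite: Deligne1982HodgeCycles, Prop. 4.4 and Thm. 4.8] [cite: Verdier1976, Cor. 5.1] -/
theorem NodalThetaSupport_of :
    (∀ ⦃𝒳 S : SchemeOver ℂ⦄ (f : 𝒳 ⟶ S) (n k : ℕ), IsSmoothProjectiveFamily f n →
      IrreducibleSpace S.left → IsQuasiProjectiveOver S → IsQuasiProjectiveOver 𝒳 →
      ∀ (𝒟 : Set 𝒳.left), IsClosed 𝒟 →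
      ∀ (σ : ComplexPoints S → FiberClass f k), Continuous σ → (∀ s, (σ s).pt = s) →
      ∀ (U : Set S.left), IsOpen U → U.Nonempty →
        (∀ s : ComplexPoints S, s.pt ∈ U → IsSupportedOnSlice 𝒟 (σ s)) →
        ∀ s : ComplexPoints S, IsSupportedOnSlice 𝒟 (σ s)) →
    (∀ ⦃𝒳 S : SchemeOver ℂ⦄ (f : 𝒳 ⟶ S) (n k : ℕ), IsSmoothProjectiveFamily f n →
      IrreducibleSpace S.left → IsQuasiProjectiveOver S → IsQuasiProjectiveOver 𝒳 →
      ∀ (𝒟 : Set 𝒳.left), IsClosed 𝒟 →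
      ∀ (σ : ComplexPoints S → FiberClass f k), Continuous σ → (∀ s, (σ s).pt = s) →
      ∃ U : Set S.left, IsOpen U ∧ U.Nonempty ∧
        ((∃ s₂ : ComplexPoints S, s₂.pt ∈ U ∧ IsSupportedOnSlice 𝒟 (σ s₂)) →
          ∀ s : ComplexPoints S, s.pt ∈ U → IsSupportedOnSlice 𝒟 (σ s))) →
    (∀ (d : ℕ), 0 < d → ∀ (A : AbelianVariety ℂ) (φ : A ⟶ A), A.dim = 2 * 3 →
      ∀ hsp : IsSmoothProjective (2 * 3) A.X, φ ≫ φ = -(d • 𝟙 A) →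
      Module.finrank ℂ ↥(Module.End.eigenspace (complexBetti.map φ.hom.hom.hom 1).hom
            (Complex.I * (Real.sqrt d : ℂ)) ⊓ hodgeOneZero hsp) = 3 →
      ∀ c : complexBetti A.X (2 * 3), c ∈ weilClassesOf A φ 3 d → c ≠ 0 → IsRationalClass c →
        IsOfHodgeType (2 * 3) A.X (2 * 3) 3 3 c →
        ∃ (𝒳 S : SchemeOver ℂ) (f : 𝒳 ⟶ S) (s₁ : ComplexPoints S) (e : A.X ≅ fiberOver f s₁)
          (σ : ComplexPoints S → FiberClass f (2 * 3)) (𝒟 : Set 𝒳.left),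
          IsSmoothProjectiveFamily f (2 * 3) ∧ IrreducibleSpace S.left ∧
          AlgebraicGeometry.Smooth S.hom ∧ IsQuasiProjectiveOver S ∧ IsQuasiProjectiveOver 𝒳 ∧
          IsClosed 𝒟 ∧ Continuous σ ∧ (∀ s, (σ s).pt = s) ∧
          σ s₁ = ⟨s₁, complexBetti.map e.inv (2 * 3) c⟩ ∧
          (fiberι f s₁).left.base ⁻¹' 𝒟 ≠ Set.univ ∧
          ∀ U : Set S.left, IsOpen U → U.Nonempty →
            ∃ s₂ : ComplexPoints S, s₂.pt ∈ U ∧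
              (σ s₂).cls ∈ algebraicClasses (fiberOver f (σ s₂).pt) 3 ∧
              IsSupportedOnSlice 𝒟 (σ s₂)) →
    Summit.HodgeConjecture.HodgeConjecture.Theses.NodalThetaWeil.NodalThetaSupport := by
  intro hS1 hS2 hS3 d hd A φ hdim hsp hφ c hr hh hw
  -- `c` lies in the Weil plane `E₊ ⊔ E₋`
  have hcW : c ∈ weilClassesOf A φ 3 d := mem_weilClassesOf_iff.mpr hw
  by_cases hc : c = 0
  · rw [hc]
    exact Submodule.zero_mem _
  -- a non-zero `(3,3)` Weil class forces balanced Weil type (Deligne–Milne 4.4, only if)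
  have hbal := finrank_eq_of_mem_weilClassesOf (m := 3) (by norm_num) hdim hd hφ hcW hc hh
  -- the seeded family through `c`
  obtain ⟨𝒳, S, f, s₁, e, σ, 𝒟, hfam, hirr, -, hqS, hq𝒳, h𝒟, hσ, hσpt, hσ₁, hne, hseed⟩ :=
    hS3 d hd A φ hdim hsp hφ hbal c hcW hc hr hh
  -- generic transport over a non-empty Zariski-open `U`
  obtain ⟨U, hU, hUne, hall⟩ := hS2 f (2 * 3) (2 * 3) hfam hirr hqS hq𝒳 𝒟 h𝒟 σ hσ hσpt
  -- a seed inside `U`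
  obtain ⟨s₂, hs₂U, -, hs₂⟩ := hseed U hU hUne
  have hUall : ∀ s : ComplexPoints S, s.pt ∈ U → IsSupportedOnSlice 𝒟 (σ s) :=
    hall ⟨s₂, hs₂U, hs₂⟩
  -- specialisation to every fibre, in particular to `s₁`
  have h₁ : IsSupportedOnSlice 𝒟 (σ s₁) :=
    hS1 f (2 * 3) (2 * 3) hfam hirr hqS hq𝒳 𝒟 h𝒟 σ hσ hσpt U hU hUne hUall s₁
  rw [hσ₁] at h₁
  change complexBetti.map e.inv (2 * 3) c ∈
    classesSupportedOn (fiberOver f s₁) ((fiberι f s₁).left.base ⁻¹' 𝒟) (2 * 3) at h₁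
  -- the slice is a proper closed subset of the smooth projective fibre: coniveau `≥ 1` there
  have hfib : IsSmoothProjective (2 * 3) (fiberOver f s₁) := hfam.isSmoothProjective s₁
  have hcl : IsClosed ((fiberι f s₁).left.base ⁻¹' 𝒟) :=
    h𝒟.preimage (fiberι f s₁).left.base.hom.continuous
  have hN : complexBetti.map e.inv (2 * 3) c ∈ supportedClasses (fiberOver f s₁) (2 * 3) 1 :=
    classesSupportedOn_le_supportedClasses hcl
      (fun z hz ↦ by exact_mod_cast one_le_coheight_of_mem_of_isClosed hfib hcl hne hz) _ h₁
  -- transport back along the isomorphism `e`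
  exact (mem_supportedClasses_map_iff_of_iso e.symm).1 hN

/-- **The crux, closed modulo exactly the three registered stubs.** -/
theorem NodalThetaSupport_of_stubs :
    Summit.HodgeConjecture.HodgeConjecture.Theses.NodalThetaWeil.NodalThetaSupport :=
  NodalThetaSupport_of stub_supportLocus_specialisation stub_supportLocus_genericTransport
    stub_seededWeilFamily

/-! ### Sanity: the slice-support predicate is inhabited in kind -/

/-- Every fibre class is supported on the slice of `𝒟 = 𝒳` (whose complement has no complex
points). [cite: GrothendieckTopology1969, §1] -/
theorem isSupportedOnSlice_univ {𝒳 S : SchemeOver ℂ} {f : 𝒳 ⟶ S} {k : ℕ} (x : FiberClass f k) :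
    IsSupportedOnSlice (Set.univ : Set 𝒳.left) x := by
  unfold IsSupportedOnSlice
  rw [Set.preimage_univ, classesSupportedOn_univ]
  exact Submodule.mem_top

/-- The zero class is supported on every slice. [folklore] -/
theorem isSupportedOnSlice_zero {𝒳 S : SchemeOver ℂ} {f : 𝒳 ⟶ S} {k : ℕ} (𝒟 : Set 𝒳.left)
    (s : ComplexPoints S) : IsSupportedOnSlice 𝒟 (⟨s, 0⟩ : FiberClass f k) :=
  Submodule.zero_mem _

end Summit.HodgeConjecture.HodgeConjecture.Cruxes.NodalThetaSupport.SupportTransport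

end
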